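import Literature.Computability.Cryptography.QubitRegister
import HarnessLib

/-!
# Qubit registers and gate placement — discharged facts

Proofs of named facts stated in `Literature.Computability.Cryptography.QubitRegister` (kept in
a sibling file so that the statement file stays a definitions/named-facts file):

* `placeGate_eq_reindex_kronecker_holds` discharges `placeGate_eq_reindex_kronecker`: the
  placement `placeGate e U` of a `k`-qubit gate on the wires `e : Fin k ↪ Fin n` is the
  Kronecker product `U ⊗ 1` transported along the wire splitting
  `splitWires e : QReg n ≃ QReg k × ((range e)ᶜ → Bool)`;
* `placeGate_mul_holds` discharges `placeGate_mul` (placement along fixed wires is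
  multiplicative);
* `placeGate_mem_unitaryGroup_holds` discharges `placeGate_mem_unitaryGroup` (placing a
  unitary gate gives a unitary operator), and `placements_subset_unitaryGroup_holds`
  discharges `QGateSet.placements_subset_unitaryGroup`;
* `sGate_mem_unitaryGroup_holds` discharges `sGate_mem_unitaryGroup` (the phase gate
  `S = diag(1, i)` is unitary).

## References

* M. A. Nielsen, I. L. Chuang, *Quantum Computation and Quantum Information*, CUP 2010,
  §4.2–4.3 (a gate on a subset of the wires acts as `U ⊗ I`; composition and unitarity);
  §4.2 eq. (4.2), book p. 174 (the phase gate `S = [[1, 0], [0, i]]`, a single-qubit unitary).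
-/

namespace Literature.Computability.Cryptography

open Matrix
open scoped Kronecker

section splitWires

variable {k n : ℕ}

/-- First component of the wire splitting: the restriction to the selected wires. [folklore] -/
@[simp] theorem splitWires_fst (e : Fin k ↪ Fin n) (x : QReg n) : (splitWires e x).1 = x ∘ e := by
  funext j
  simp [splitWires]

/-- Second component of the wire splitting: the restriction to the other wires. [folklore] -/
@[simp] theorem splitWires_snd (e : Fin k ↪ Fin n) (x : QReg n)
    (l : ((Set.range e)ᶜ : Set (Fin n))) : (splitWires e x).2 l = x l := by
  simp [splitWires]

/-- Two labels have the same off-wire part iff they agree off the selected wires. [folklore] -/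
theorem splitWires_snd_eq_iff (e : Fin k ↪ Fin n) (x y : QReg n) :
    (splitWires e x).2 = (splitWires e y).2 ↔ ∀ i, i ∉ Set.range e → x i = y i := by
  simp only [funext_iff, splitWires_snd, Subtype.forall, Set.mem_compl_iff]

end splitWires

section placeGate

variable {R : Type*} [CommRing R] {k n : ℕ}

/-- Discharge of `placeGate_eq_reindex_kronecker`: `placeGate e U` is `U ⊗ₖ 1` reindexed along
`splitWires e` (compare entries: both are `U (x ∘ e) (y ∘ e)` if `x`, `y` agree off the range
of `e`, else `0`). [Nielsen–Chuang 2010, §4.3] [cite: NielsenChuang2010, §4.3] -/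
theorem placeGate_eq_reindex_kronecker_holds :
    placeGate_eq_reindex_kronecker (R := R) (k := k) (n := n) := by
  intro e U
  ext x y
  rw [placeGate_apply, reindex_apply, submatrix_apply, Equiv.symm_symm, kroneckerMap_apply,
    splitWires_fst, splitWires_fst, Matrix.one_apply]
  simp only [splitWires_snd_eq_iff, mul_ite, mul_one, mul_zero]

/-- Discharge of `placeGate_mul`: placement along fixed wires is multiplicative,
`placeGate e (U V) = placeGate e U · placeGate e V` (`(U V) ⊗ 1 = (U ⊗ 1)(V ⊗ 1)` and
reindexing along an equivalence is multiplicative). [Nielsen–Chuang 2010, §4.2] [cite: NielsenChuang2010, §4.2] -/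
theorem placeGate_mul_holds : placeGate_mul (R := R) (k := k) (n := n) := by
  intro e U V
  rw [placeGate_eq_reindex_kronecker_holds e, placeGate_eq_reindex_kronecker_holds e,
    placeGate_eq_reindex_kronecker_holds e, reindex_apply, reindex_apply, reindex_apply,
    submatrix_mul_equiv, ← mul_kronecker_mul, Matrix.one_mul]

/-- Reindexing a unitary matrix along an equivalence gives a unitary matrix. [folklore] -/
theorem submatrix_mem_unitaryGroup {ι κ : Type*} [Fintype ι] [DecidableEq ι] [Fintype κ]
    [DecidableEq κ] [StarRing R] (f : κ ≃ ι) {M : Matrix ι ι R}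
    (hM : M ∈ Matrix.unitaryGroup ι R) : M.submatrix f f ∈ Matrix.unitaryGroup κ R := by
  rw [Matrix.mem_unitaryGroup_iff] at hM ⊢
  rw [star_eq_conjTranspose, conjTranspose_submatrix, submatrix_mul_equiv,
    ← star_eq_conjTranspose, hM, submatrix_one_equiv]

/-- Discharge of `placeGate_mem_unitaryGroup`: placing a unitary gate yields a unitary
operator (`U ⊗ 1` is unitary, `Matrix.kronecker_mem_unitary`, and reindexing preserves
unitarity). [Nielsen–Chuang 2010, §4.3] [cite: NielsenChuang2010, §4.3] -/
theorem placeGate_mem_unitaryGroup_holds :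
    placeGate_mem_unitaryGroup (R := R) (k := k) (n := n) := by
  intro _ e U hU
  rw [placeGate_eq_reindex_kronecker_holds e, reindex_apply]
  exact submatrix_mem_unitaryGroup _
    (Matrix.kronecker_mem_unitary hU (Submonoid.one_mem _))

/-- Discharge of `QGateSet.placements_subset_unitaryGroup`: every placement of a gate of a
unitary gate set is unitary. [Nielsen–Chuang 2010, §4.5] [cite: NielsenChuang2010, §4.5] -/
theorem QGateSet.placements_subset_unitaryGroup_holds : QGateSet.placements_subset_unitaryGroup := by
  rintro G hG n M ⟨g, e, rfl⟩
  exact placeGate_mem_unitaryGroup_holds e (hG g)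

end placeGate

section namedGates

/-- The phase gate is the diagonal matrix `diag(1, i)` (definitional unfolding of `sGate`).
[Nielsen–Chuang 2010, §4.2 eq. (4.2)] [cite: NielsenChuang2010, §4.2 eq. (4.2)] -/
theorem sGate_eq_diagonal :
    sGate = Matrix.diagonal fun x : QReg 1 => if x 0 = true then Complex.I else 1 := by
  ext x y
  rw [sGate, Matrix.of_apply, Matrix.diagonal_apply]

/-- **Discharge of `sGate_mem_unitaryGroup`.** The phase gate `S = diag(1, i)` of
Nielsen–Chuang §4.2, eq. (4.2) (book p. 174) is unitary: `S S† = diag(1 · 1, i · ī) = diag(1, 1) = 1`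
since `i ī = 1` (`Complex.conj_I`, `Complex.I_mul_I`). Single-qubit gates are `2 × 2` unitary
matrices (ibid., §4.2, opening paragraph). [cite: NielsenChuang2010, §4.2 eq. (4.2)] -/
theorem sGate_mem_unitaryGroup_holds : sGate_mem_unitaryGroup := by
  rw [sGate_mem_unitaryGroup, Matrix.mem_unitaryGroup_iff, sGate_eq_diagonal,
    star_eq_conjTranspose, diagonal_conjTranspose, diagonal_mul_diagonal, ← diagonal_one]
  congr 1
  funext x
  by_cases hx : x 0 = true
  · simp [hx, Complex.conj_I]
  · simp [hx]

end namedGates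

end Literature.Computability.Cryptography
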